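import Mathlib
import HarnessLib
import Summits.HubbardSuperconductivity.HubbardSuperconductivity.Theorems.KLProgrammeKLRegimeEngineTowerLevAssemblyKlEngNumerics
import Summits.HubbardSuperconductivity.HubbardSuperconductivity.Theorems.KLProgrammeKLRegimeEngineTowerLevAssemblyKlEngNum
import Summits.HubbardSuperconductivity.HubbardSuperconductivity.Theorems.KLProgrammeKLRegimeEngineTowerLevNumericsPackageRB
import Summits.HubbardSuperconductivity.HubbardSuperconductivity.Theorems.KLProgrammeKLRegimeEngineTowerLevNumericsPackageZN

/-!
# Route `KLProgramme` — crux K3 ENGINE (stmt-HubbardSuperconductivity-20437 `KLRegimeEngineV17F2`), stub (b) v2, THE LEVELS PACKAGE (ℓ), numerics side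
# «(ℓ)-NUMERICS-FINAL-S» (cell gate-hubbard-kl, seat p4 g22): THE LEVELS CLAUSE ON THE FLOW FRAME MODULO E1's STRUCTURAL ROWS ONLY —
# p3 g22's hypothesis-minimal head `kernelNormsLevels_all_klEng_numerics` (p704093) with EVERY numerics binder (main tower AND block 0) discharged on shapes

p3's `…_numerics` leaves: E1's structural rows (main-tower imports `ι₁ ι₂`, six-leg cells `X`/`hsix`, blocking, `B ≥ B₀`), the pure numerics (caps,
both coupling doors, the main CE rows, block 0's five inequalities in the level-0 constants `(A₁, P₁, T₁)`, its smallness rows `j ≤ d`, CE rows `j < d`, the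
domination `Atot₁ ≤ Ab'`, `Qtot₁ ≤ Qb`), the pinned names, and `(klEngQ7 P R).IsRaiseOf Qe`.  Here ALL pure numerics are discharged: the main tower by
`levNumerics_packageRB` (as `…_numRC`; base amplitudes are OUTPUTS `Ab = ab·(β/M)`, `Qb = qb·(M/β)²`), block 0 by `levNumerics_packageZN` with the pins
`A′₀ := 27⁵W₀Ab₀`, `Q′₀ := Z₀Qb₀ + 1`, `ι₃₀ := A′₀Q′₀³`, the four-leg slot `ι₂₀ := W₀Z₀²·27⁵A₁P₁²|U|/(ε_x³·Bf·ε₁) ≤ i₂₀(M/β)³/Bf` and the two-leg slot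
`ι₁₀ := W₀Z₀·27⁵T₁(|U| + c)/(ε_x·Bf·ε₁)` — `O(|U| + c)`, not `O(λ)`: its product bound `ι₁₀·λ_j ≤ (M/β)/Bf` (`j ≤ d`) comes from the NEW door
**`|U|, c ≤ ug := 1/(2·G·Bf + 1)`, `G = 2·27⁵·W₀Z₀·T₁·(d + 1)`**; the domination at `λ_d` needs no `d ≤ n` thanks to the door `uf ≤ 1/d`; caps by
`exists_degreeCap_all`, blocking by `exists_blockLen_klEng`.  **`kernelNormsLevels_all_klEng_numS (c″)`**: head = link constants, `∃ d₀ ≥ 2, ∀ d ≥ d₀`, block 0's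
constants, `∀ P, P.WF → ∃ A₁ P₁ T₁ c₀ U₀‴`, the import SHAPES `i₁ i₂ x₆ ≥ 0`, the OUTPUTS `∃ ab qb Bf uf CEf ug`, doors, regime, the main tower's binders verbatim
`…_numRC`, `CEf ≤ Qe.CE`, `hsix`, `IsRaiseOf` ⊢ `∀ j ≤ n, KernelNormsLevels … j`.  **No numerics binder and no block-0 binder remains.**  Composition of landed
theorems + KL-regime arithmetic; nothing asserts (ℓ), any stub, K3 or superconductivity.
References: BGM 2006 §2.8 (2.76)–(2.84), (2.93)–(2.98), Lemma 2.5, §3 (3.2)–(3.8) [cite: BenfattoGiulianiMastropietro2006].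
-/

noncomputable section

namespace Summit.HubbardSuperconductivity.HubbardSuperconductivity.Theorems.EngineV8

set_option linter.dupNamespace false -- summit = problem name (single-conjunct summit), D-0017

open Classical
open Real Finset Literature.MathematicalPhysics.QuantumLattice Literature.Probability.LatticeModels GrassmannAlgebra
open Literature.Probability.LatticeModels.BattleFederbush
open Literature.MathematicalPhysics.QuantumLattice.FermiRG
open Summit.HubbardSuperconductivity.HubbardSuperconductivity.Theorems.KLProgrammeLegKernels
open Summit.HubbardSuperconductivity.HubbardSuperconductivity.Theorems.KLRegimeSplit
open Summit.HubbardSuperconductivity.HubbardSuperconductivity.Theorems.KLRegimeWick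
open Summit.HubbardSuperconductivity.HubbardSuperconductivity.Theorems.TorusFourierL2
open Summit.HubbardSuperconductivity.HubbardSuperconductivity.Theorems.DispersionFlow

variable {L M : ℕ} [NeZero L] [NeZero M]

set_option maxHeartbeats 2000000 in -- one ~180-binder composition + three packages' closed forms
/-- **THE LEVELS CLAUSE ON THE FLOW FRAME MODULO E1's STRUCTURAL ROWS ONLY** (every numerics binder of `kernelNormsLevels_all_klEng_numerics` discharged on shapes;
see the module docstring). [cite: BenfattoGiulianiMastropietro2006, §2.8 (2.76)-(2.84), (2.93)-(2.98), Lemma 2.5, §3 (3.2)-(3.8)] -/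
theorem kernelNormsLevels_all_klEng_numS (c'' : ℝ) (hc'' : 0 < c'') :
    ∃ C₁ C₂ C₁' C₂' Cinc Dinc : ℝ, 0 < C₁ ∧ 0 < C₂ ∧ 0 < C₁' ∧ 0 < C₂' ∧ 0 < Cinc ∧ 1 ≤ Dinc ∧
    ∀ R : RenConsts, R.WF2 → ∃ c₃' : ℝ, 0 < c₃' ∧ ∃ U₀' : ℝ, 0 < U₀' ∧
      ∃ Cκ CJ : ℝ, 0 < Cκ ∧ 0 < CJ ∧ ∃ d₀ : ℕ, 2 ≤ d₀ ∧ ∀ d : ℕ, d₀ ≤ d → ∃ Cb : ℝ, 0 < Cb ∧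
      ∃ Cinc₀ Dinc₀ Cinc₁ Dinc₁ c₃'' U₀'' : ℝ, 0 < Cinc₀ ∧ 1 ≤ Dinc₀ ∧ 1 ≤ Cinc₁ ∧ 1 ≤ Dinc₁ ∧ 0 < c₃'' ∧ 0 < U₀'' ∧
      ∃ Cκ₀ Cb₀ CJ₀ : ℝ, 0 < Cκ₀ ∧ 0 < Cb₀ ∧ 0 < CJ₀ ∧
      -- the level-0 datum's constants and doors (p3's `exists_levelZeroDatum_klEng P R`), indexed by `P`
      ∀ P : SplitConsts, P.WF → ∃ A₁ P₁ T₁ c₀ U₀''' : ℝ, 0 < A₁ ∧ 0 < P₁ ∧ 0 < T₁ ∧ 0 < c₀ ∧ 0 < U₀''' ∧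
      -- the SHAPE constants of E1's main-tower imports
      ∀ (i₁ i₂ x₆ : ℝ), 0 ≤ i₁ → 0 ≤ i₂ → 0 ≤ x₆ →
      -- the numerics' OUTPUTS: the main tower's base amplitudes `ab qb`, the coupling rescaling `Bf`, the doors `uf` and `ug`, the public threshold `CEf`
      ∃ ab qb Bf uf CEf ug : ℝ, 0 < ab ∧ 0 < qb ∧ 1 ≤ Bf ∧ 0 < uf ∧ 0 ≤ CEf ∧ 0 < ug ∧
      ∀ (G : GeoConsts) (Qh : EngConsts) (c : ℝ), 0 < c → c ≤ klEngC₃6 P R → c ≤ c₃' → c ≤ c₃'' → c ≤ c₀ → c ≤ ug →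
      ∀ μ ∈ klWindowC, ∀ U : ℝ, 0 < U → U ≤ klEngU₀9 P R c → U ≤ U₀' → U ≤ U₀'' → U ≤ U₀''' → c'' * U ≤ 1 → U ≤ uf / (2 * Bf * P.Klam + 1) → U ≤ ug →
      ∀ β : ℝ, klBetaMin ≤ β → β ≤ Real.exp (c / U ^ 2) →
      ∀ (L M : ℕ) [NeZero L] [NeZero M], klEngL₃ β U ≤ L → klEngM₃ β U L ≤ M →
      ∀ n : ℕ, 1 ≤ n → n ≤ nScales β + 1 → IsKLRegime U c (-(n : ℤ)) →
        HistP klPredsV17F2 L M G P Qh R β U μ 0 n → FrameOK R U (nScales β) μ (klFlowFrameU L M β U μ n) →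
        (∀ m, 1 ≤ m → m < n → FlowPieceOscAt L M c'' β U μ m) →
      ∀ (cc : ℝ) (n' : ℕ), IsKLRegime U cc (-(n' : ℤ)) → n ≤ n' → cc ≤ uf * Real.log 4 / (2 * Bf * P.Klam + 1) →
      -- the main tower's base AMPLITUDES (outputs, pinned: `Ab = ab·(β/M)`, `Qb = qb·(M/β)²`), E1's imports ON THEIR SHAPES, the primed versions at `B := Bf`
      ∀ (Ab Qb ι₂ X : ℝ), Ab = ab * (β / M) → Qb = qb * ((M : ℝ) / β) ^ 2 → 0 ≤ ι₂ → ι₂ ≤ i₂ * ((M : ℝ) / β) ^ 3 → 0 ≤ X → X ≤ x₆ * ((M : ℝ) / β) ^ 5 →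
      ∀ (Ab' ι₂' X' : ℝ), Ab' = Ab / Bf ^ 2 → ι₂' = ι₂ / Bf → X' = X / Bf ^ 2 →
      -- the floor LINK data DISCHARGED on the flow frame (`linkDataPartialF_klEng'`): the four k-free constants pinned, the degree cap kept
      ∀ (κb αb crb ccb : ℝ), κb = Real.sqrt (2 * Cκ * klE0) → αb = Cb * ((M : ℝ) / β) * (4 : ℝ) ^ d / klE0 →
        crb = 81 * CJ * M / β → ccb = 162 * CJ * M / β →
      -- the law's six names PINNED by the link (equational binders), and the import `ι₁`
      ∀ (W Z σ Φ ψ τ ι₁ : ℝ), W = 64 * (27 : ℝ) ^ 4 * exp 2 * crb / ccb → Z = exp 4 * ccb ^ 2 * imagTimeWeight β M ^ 2 / 8 →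
        σ = κb ^ 2 / (exp 4 * ccb ^ 2) → Φ = 9 * αb * ccb / ((27 : ℝ) ^ 5 * exp 1 * κb ^ 2 * crb) → ψ = exp 4 * ccb ^ 2 / κb ^ 2 →
        τ = exp 2 * κb ^ 2 / ccb ^ 2 → 0 ≤ ι₁ → ι₁ ≤ i₁ * ((M : ℝ) / β) →
      ∀ (ρk Q' Q κA Yb Y A A' ι₃ : ℝ), ρk = max 4 (2 * τ * ψ) → Q' = Z * Qb + 1 → Q = ρk * Q' →
        κA = W * ((27 : ℝ) ^ 5 * (C₁ / C₂) * (8 : ℝ) ^ (d - 1)) →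
        Yb = ι₂ / (2 * Q') + W * Z ^ 3 * X / (4 * Q' ^ 2) + (W * (27 : ℝ) ^ 5 * Ab + κA * Ab) * Q' / 2 →
        Y = ι₂' / (2 * Q') + W * Z ^ 3 * X' / (4 * Q' ^ 2) + (W * (27 : ℝ) ^ 5 * Ab' + κA * Ab') * Q' / 2 →
        A = 2 * Y * (1 - ((2 : ℝ) ^ d)⁻¹) / (κA * Q') →
        A' = (W * (27 : ℝ) ^ 5 * Ab' + κA * Ab') + 2 * Y / Q' → ι₃ = W * Z ^ 3 * X' + A' * Q' ^ 3 →
      -- E1's imports and six-leg cells, block by block, each at the block's own base level `λ_{dk} = Bf·ε_{dk}` (monotone in the level)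
      (∀ k, 1 ≤ k → d * k ≤ n → W * Z ^ 1 * klTowerMuLevF L M β U μ (klFlowFrameU L M β U μ n) d k 1 ≤ ι₁ * (Bf * epsCoupling P U (d * k))) →
      (∀ k, 1 ≤ k → d * k ≤ n → W * Z ^ 2 * klTowerMuLevF L M β U μ (klFlowFrameU L M β U μ n) d k 2 ≤ ι₂' * (Bf * epsCoupling P U (d * k))) →
      (∀ k, 2 ≤ k → d * k ≤ n → klTowerMuLevAtF L M β U μ (klFlowFrameU L M β U μ n) d 0 k 3 ≤ X' * (Bf * epsCoupling P U (d * k)) ^ 2) →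
      -- the read-out constants (equational binders; `Atot` level by level through `λ_j = Bf·ε_j`), the public constant's threshold at every level `d ≤ j ≤ n`,
      -- the degree cap, the six-leg cells at every level `d ≤ j ≤ n`
      ∀ (Aro Qro Qtot : ℝ) (Atot : ℕ → ℝ), Aro = (27 : ℝ) ^ 5 * (C₁' / C₂') * (Ab' + (8 : ℝ) ^ (d - 1) * (A / (1 - ((2 : ℝ) ^ d)⁻¹))) →
        Qro = C₂' ^ 2 * max Qb (((2 : ℝ) ^ (d - 1))⁻¹ * max Q Qb) → Qtot = Dinc * max 1 (max Qro (max (4 * Q') (2 * τ * ψ * Q'))) →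
        (∀ j : ℕ, Atot j = Aro + Cinc * (A' * (4 * σ * (Bf * epsCoupling P U j) * Q' / (1 - 4 * σ * (Bf * epsCoupling P U j) * Q')) +
          exp 1 * (τ * (ι₁ * (Bf * epsCoupling P U j) + ι₂' / (2 * Q') + ι₃ / (4 * Q' ^ 2) + A' * Q' / 4)) *
            (Φ * (τ * (ι₁ * (Bf * epsCoupling P U j) + ι₂' / (2 * Q') + ι₃ / (4 * Q' ^ 2) + A' * Q' / 4)) /
              (1 - Φ * (τ * (ι₁ * (Bf * epsCoupling P U j) + ι₂' / (2 * Q') + ι₃ / (4 * Q' ^ 2) + A' * Q' / 4)))) / (2 * τ * Q'))) →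
      ∀ Qe : EngConsts, CEf ≤ Qe.CE →
      (∀ j : ℕ, 1 ≤ j → j ≤ n → ∀ Ωe : Fin (2 * 3) → Option (SectorLeg (sectorCount j)), levelCount Ωe = 1 →
        klAnisoLegKernelNormAt L M β U μ (klFlowFrameU L M β U μ n) klE0 j (2 * 3) Ωe ≤ Qe.CE ^ 3 * (epsCoupling P U j) ^ 2 * (2 : ℝ) ^ ((4 : ℤ) * j)) →
      -- THE LEVEL `j = 0`: the numerics package is a raise of `klEngQ7 P R`
      (klEngQ7 P R).IsRaiseOf Qe →
      ∀ j : ℕ, j ≤ n → KernelNormsLevels L M P Qe β U μ (klFlowFrameU L M β U μ n) j := by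
  obtain ⟨C₁, C₂, C₁', C₂', Cinc, Dinc, hC₁, hC₂, hC₁', hC₂', hCinc, hDinc, h⟩ := kernelNormsLevels_all_klEng_numerics c'' hc''
  refine ⟨C₁, C₂, C₁', C₂', Cinc, Dinc, hC₁, hC₂, hC₁', hC₂', hCinc, hDinc, fun R hR2 => ?_⟩
  obtain ⟨c₃, hc₃, U₀, hU₀, Cκ, CJ, hCκ, hCJ, hd⟩ := h R hR2
  obtain ⟨d₀, hd₀2, hblk⟩ := exists_blockLen_klEng C₂ CJ
  refine ⟨c₃, hc₃, U₀, hU₀, Cκ, CJ, hCκ, hCJ, d₀, hd₀2, fun d hd₀d => ?_⟩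
  obtain ⟨Cb, hCb, Cinc₀, Dinc₀, Cinc₁, Dinc₁, c₃'', U₀'', hCinc₀, hDinc₀, hCinc₁, hDinc₁, hc₃'', hU₀'', Cκ₀, Cb₀, CJ₀, hCκ₀, hCb₀, hCJ₀, hP⟩ := hd d
  refine ⟨Cb, hCb, Cinc₀, Dinc₀, Cinc₁, Dinc₁, c₃'', U₀'', hCinc₀, hDinc₀, hCinc₁, hDinc₁, hc₃'', hU₀'', Cκ₀, Cb₀, CJ₀, hCκ₀, hCb₀, hCJ₀, fun P hPwf => ?_⟩
  obtain ⟨A₁, P₁, T₁, c₀, U₀''', hA₁, hP₁, hT₁, hc₀, hU₀''', h'⟩ := hP P hPwf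
  refine ⟨A₁, P₁, T₁, c₀, U₀''', hA₁, hP₁, hT₁, hc₀, hU₀''', ?_⟩
  intro i₁ i₂ x₆ hi₁ hi₂ hx₆
  have hd2 : 2 ≤ d := le_trans hd₀2 hd₀d
  have hK1 : 1 ≤ P.Klam := hPwf.1
  have hK0 : 0 < P.Klam := lt_of_lt_of_le one_pos hK1
  have he0 : (0 : ℝ) < klE0 := by norm_num [klE0]
  obtain ⟨ab₀, hab₀⟩ : ∃ x : ℝ, x = A₁ / (2 * P.Klam ^ 2) := ⟨_, rfl⟩
  obtain ⟨qb₀, hqb₀⟩ : ∃ x : ℝ, x = 4 * P₁ := ⟨_, rfl⟩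
  have hab₀0 : 0 < ab₀ := by rw [hab₀]; positivity
  have hqb₀0 : 0 < qb₀ := by rw [hqb₀]; positivity
  obtain ⟨zW, hzW⟩ : ∃ x : ℝ, x = 32 * (27 : ℝ) ^ 4 * exp 2 := ⟨_, rfl⟩
  obtain ⟨zZ, hzZ⟩ : ∃ x : ℝ, x = exp 4 * (81 * CJ₀) ^ 2 / 8 := ⟨_, rfl⟩
  have hzW0 : 0 < zW := by rw [hzW]; positivity
  have hzZ0 : 0 < zZ := by rw [hzZ]; positivity
  obtain ⟨i₂₀, hi₂₀⟩ : ∃ x : ℝ, x = 8 * (27 : ℝ) ^ 5 * zW * zZ ^ 2 * A₁ * P₁ ^ 2 / P.Klam := ⟨_, rfl⟩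
  have hi₂₀0 : 0 ≤ i₂₀ := by rw [hi₂₀]; positivity
  obtain ⟨zs, hzs⟩ : ∃ x : ℝ, x = 2 * Cκ₀ * klE0 / (exp 4 * 162 ^ 2 * CJ₀ ^ 2) := ⟨_, rfl⟩
  obtain ⟨zt, hzt⟩ : ∃ x : ℝ, x = exp 2 * (2 * Cκ₀ * klE0) / (162 ^ 2 * CJ₀ ^ 2) := ⟨_, rfl⟩
  obtain ⟨zp, hzp⟩ : ∃ x : ℝ, x = exp 4 * 162 ^ 2 * CJ₀ ^ 2 / (2 * Cκ₀ * klE0) := ⟨_, rfl⟩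
  obtain ⟨zφ, hzφ⟩ : ∃ x : ℝ, x = 9 * Cb₀ * (4 : ℝ) ^ d / ((27 : ℝ) ^ 5 * exp 1 * Cκ₀ * klE0 ^ 2) := ⟨_, rfl⟩
  obtain ⟨zQL, hzQL⟩ : ∃ x : ℝ, x = zZ * qb₀ := ⟨_, rfl⟩
  obtain ⟨zQH, hzQH⟩ : ∃ x : ℝ, x = zZ * qb₀ + 1 := ⟨_, rfl⟩
  obtain ⟨zaP, hzaP⟩ : ∃ x : ℝ, x = (27 : ℝ) ^ 5 * zW * ab₀ := ⟨_, rfl⟩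
  obtain ⟨zsC, hzsC⟩ : ∃ x : ℝ, x = i₂₀ / (2 * zQL) + zaP * zQH ^ 3 / (4 * zQL ^ 2) + zaP * zQH / 4 := ⟨_, rfl⟩
  obtain ⟨zΘ, hzΘ⟩ : ∃ x : ℝ, x = exp 1 ^ 2 * zφ * zt ^ 2 * i₂₀ + exp 1 ^ 3 * zφ * zt ^ 3 * (zaP * zQH ^ 3) + exp 1 ^ 3 * zφ * zt ^ 3 * zaP * zQH ^ 3 := ⟨_, rfl⟩
  obtain ⟨uf₀, huf₀⟩ : ∃ x : ℝ, x = min 1 (min (1 / (8 * zs * zQH + 1)) (min (1 / (2 * exp 1 * zt * zQH + 1)) (1 / (4 * zΘ + 1)))) := ⟨_, rfl⟩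
  obtain ⟨aT₀, haT₀⟩ : ∃ x : ℝ, x = Cinc₀ * (ab₀ + zaP + exp 1 * zφ * zt * (1 + zsC) ^ 2 / zQL) := ⟨_, rfl⟩
  obtain ⟨ab, hab⟩ : ∃ x : ℝ, x = Cinc₁ * (ab₀ + zaP + exp 1 * zφ * zt * (1 + zsC) ^ 2 / zQL) := ⟨_, rfl⟩
  obtain ⟨qT₀, hqT₀⟩ : ∃ x : ℝ, x = Dinc₀ * (1 + Dinc₀ * qb₀ + 4 * zQH + 2 * zt * zp * zQH) / 4 := ⟨_, rfl⟩
  obtain ⟨qb, hqb⟩ : ∃ x : ℝ, x = Dinc₁ * (1 + Dinc₁ * qb₀ + 4 * zQH + 2 * zt * zp * zQH) := ⟨_, rfl⟩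
  obtain ⟨pW, hpW⟩ : ∃ x : ℝ, x = 32 * (27 : ℝ) ^ 4 * exp 2 := ⟨_, rfl⟩
  obtain ⟨pZ, hpZ⟩ : ∃ x : ℝ, x = exp 4 * (81 * CJ) ^ 2 / 8 := ⟨_, rfl⟩
  obtain ⟨ps, hps⟩ : ∃ x : ℝ, x = 2 * Cκ * klE0 / (exp 4 * 162 ^ 2 * CJ ^ 2) := ⟨_, rfl⟩
  obtain ⟨pt, hpt⟩ : ∃ x : ℝ, x = exp 2 * (2 * Cκ * klE0) / (162 ^ 2 * CJ ^ 2) := ⟨_, rfl⟩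
  obtain ⟨pp, hpp⟩ : ∃ x : ℝ, x = exp 4 * 162 ^ 2 * CJ ^ 2 / (2 * Cκ * klE0) := ⟨_, rfl⟩
  obtain ⟨pφ, hpφ⟩ : ∃ x : ℝ, x = 9 * Cb * (4 : ℝ) ^ d / ((27 : ℝ) ^ 5 * exp 1 * Cκ * klE0 ^ 2) := ⟨_, rfl⟩
  obtain ⟨pρ, hpρ⟩ : ∃ x : ℝ, x = 2 * exp 6 := ⟨_, rfl⟩
  obtain ⟨pκ, hpκ⟩ : ∃ x : ℝ, x = pW * ((27 : ℝ) ^ 5 * (C₁ / C₂) * (8 : ℝ) ^ (d - 1)) := ⟨_, rfl⟩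
  obtain ⟨QL, hQL⟩ : ∃ x : ℝ, x = pZ * qb := ⟨_, rfl⟩
  obtain ⟨QH, hQH⟩ : ∃ x : ℝ, x = pZ * qb + 1 := ⟨_, rfl⟩
  obtain ⟨yB, hyB⟩ : ∃ x : ℝ, x = i₂ / (2 * QL) + pW * pZ ^ 3 * x₆ / (4 * QL ^ 2) + (pW * (27 : ℝ) ^ 5 + pκ) * ab * QH / 2 := ⟨_, rfl⟩
  obtain ⟨aPB, haPB⟩ : ∃ x : ℝ, x = (pW * (27 : ℝ) ^ 5 + pκ) * ab + 2 * yB / QL := ⟨_, rfl⟩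
  obtain ⟨i₃B, hi₃B⟩ : ∃ x : ℝ, x = pW * pZ ^ 3 * x₆ + aPB * QH ^ 3 := ⟨_, rfl⟩
  obtain ⟨sCB, hsCB⟩ : ∃ x : ℝ, x = i₂ / (2 * QL) + i₃B / (4 * QL ^ 2) + aPB * QH / 4 := ⟨_, rfl⟩
  obtain ⟨Bf, hBf⟩ : ∃ x : ℝ, x = max (max (max 1 (max (8 * pφ * pt * yB) (512 * exp 1 * pp ^ 3 * pt ^ 4 * pφ * pκ * yB / (3 * pρ ^ 3)))) (4 * pφ * pt * sCB))
      (4 * exp 1 * zφ * zt * (1 + zsC)) := ⟨_, rfl⟩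
  obtain ⟨yP, hyP⟩ : ∃ x : ℝ, x = i₂ / (2 * Bf * QL) + pW * pZ ^ 3 * x₆ / (4 * Bf ^ 2 * QL ^ 2) + (pW * (27 : ℝ) ^ 5 + pκ) * ab * QH / (2 * Bf ^ 2) := ⟨_, rfl⟩
  obtain ⟨yL, hyL⟩ : ∃ x : ℝ, x = (pW * (27 : ℝ) ^ 5 + pκ) * ab * QL / (2 * Bf ^ 2) := ⟨_, rfl⟩
  obtain ⟨aP, haP⟩ : ∃ x : ℝ, x = (pW * (27 : ℝ) ^ 5 + pκ) * ab / Bf ^ 2 + 2 * yP / QL := ⟨_, rfl⟩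
  obtain ⟨aA, haA⟩ : ∃ x : ℝ, x = 2 * yP / (pκ * QL) := ⟨_, rfl⟩
  obtain ⟨aL, haL⟩ : ∃ x : ℝ, x = 3 * yL / (2 * pκ * QH) := ⟨_, rfl⟩
  obtain ⟨i₃c, hi₃c⟩ : ∃ x : ℝ, x = pW * pZ ^ 3 * x₆ / Bf ^ 2 + aP * QH ^ 3 := ⟨_, rfl⟩
  obtain ⟨sC, hsC⟩ : ∃ x : ℝ, x = i₂ / (2 * Bf * QL) + i₃c / (4 * QL ^ 2) + aP * QH / 4 := ⟨_, rfl⟩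
  obtain ⟨Sf, hSf⟩ : ∃ x : ℝ, x = exp 1 * pφ * pt * i₁ + exp 1 ^ 2 * pφ * pt ^ 2 * (i₂ / Bf) + exp 1 ^ 3 * pφ * pt ^ 3 * i₃c + pφ * aP * exp 1 ^ 2 * pt ^ 2 * QH ^ 2 / 2 := ⟨_, rfl⟩
  obtain ⟨R₆, hR₆⟩ : ∃ x : ℝ, x = 1024 * ps * aP * QH / (aL * pρ ^ 3) := ⟨_, rfl⟩
  obtain ⟨R₇, hR₇⟩ : ∃ x : ℝ, x = 64 * exp 1 * pp ^ 3 * pt ^ 4 * pφ * QH ^ 2 * i₁ ^ 2 / (aL * pρ ^ 3 * QL ^ 3) := ⟨_, rfl⟩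
  obtain ⟨ufm, hufm⟩ : ∃ x : ℝ, x = min 1 (min (1 / (8 * ps * QH + 1)) (min (1 / (2 * exp 1 * pt * QH + 1)) (min (1 / (4 * pφ * pt * i₁ + 1))
      (min (1 / (2 * Sf + 1)) (min (1 / (R₆ + 1)) (1 / (R₇ + 1))))))) := ⟨_, rfl⟩
  obtain ⟨qT, hqT⟩ : ∃ x : ℝ, x = Dinc * (1 + C₂' ^ 2 * (2 * qb + pρ * QH) + 4 * QH + 2 * pt * pp * QH) / 4 := ⟨_, rfl⟩
  obtain ⟨aT, haT⟩ : ∃ x : ℝ, x = (27 : ℝ) ^ 5 * (C₁' / C₂') * (ab / Bf ^ 2 + 4 / 3 * (8 : ℝ) ^ (d - 1) * aA) + Cinc * (aP + exp 1 * (i₁ + sC) / (2 * QL)) := ⟨_, rfl⟩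
  obtain ⟨CEfm, hCEfm⟩ : ∃ x : ℝ, x = qT * Bf * max 1 (2 * aT) := ⟨_, rfl⟩
  obtain ⟨uf, huf⟩ : ∃ x : ℝ, x = min (min ufm uf₀) (1 / (d : ℝ)) := ⟨_, rfl⟩
  obtain ⟨CEf₀, hCEf₀⟩ : ∃ x : ℝ, x = qT₀ * Bf * max 1 (2 * aT₀) := ⟨_, rfl⟩
  obtain ⟨CEf, hCEf⟩ : ∃ x : ℝ, x = max CEfm CEf₀ := ⟨_, rfl⟩
  obtain ⟨Gf, hGf⟩ : ∃ x : ℝ, x = 2 * (27 : ℝ) ^ 5 * zW * zZ * T₁ * ((d : ℝ) + 1) := ⟨_, rfl⟩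
  obtain ⟨ug, hug⟩ : ∃ x : ℝ, x = 1 / (2 * Gf * Bf + 1) := ⟨_, rfl⟩
  have hBfm : max (max 1 (max (8 * pφ * pt * yB) (512 * exp 1 * pp ^ 3 * pt ^ 4 * pφ * pκ * yB / (3 * pρ ^ 3)))) (4 * pφ * pt * sCB) ≤ Bf := by
    rw [hBf]; exact le_max_left _ _
  have hBf1 : 1 ≤ Bf := le_trans (le_trans (le_max_left _ _) (le_max_left _ _)) hBfm
  have hBf0 : 0 < Bf := lt_of_lt_of_le one_pos hBf1
  have hBf₀ : 4 * exp 1 * zφ * zt * (1 + zsC) ≤ Bf := by rw [hBf]; exact le_max_right _ _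
  obtain ⟨huf₀0, hab0, hqb0, hCEf₀0, hpkgZ⟩ := levNumerics_packageZN hCinc₀ hDinc₀ hCinc₁ hDinc₁ hCκ₀ hCb₀ hCJ₀ hab₀0 hqb₀0 hi₂₀0
    hzW hzZ hzs hzt hzp hzφ hzQL hzQH hzaP hzsC hzΘ huf₀ haT₀ hab hqT₀ hqb hCEf₀ hBf1 hBf₀
  obtain ⟨-, hufm0, hCEfm0, hpkg⟩ := levNumerics_packageRB hC₁ hC₂ hC₁' hC₂' hCinc hDinc hCκ hCb hCJ hK1 hd2 hab0 hqb0 hi₁ hi₂ hx₆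
    hpW hpZ hps hpt hpp hpφ hpρ hpκ hQL hQH hyB haPB hi₃B hsCB hBfm hyP hyL haP haA haL hi₃c hsC hSf hR₆ hR₇ hufm hqT haT hCEfm
  have hd0r : (0 : ℝ) < d := Nat.cast_pos.2 (by omega)
  have huf0 : 0 < uf := by rw [huf]; exact lt_min (lt_min hufm0 huf₀0) (by positivity)
  have hufm_le : uf ≤ ufm := by rw [huf]; exact (min_le_left _ _).trans (min_le_left _ _)
  have huf₀_le : uf ≤ uf₀ := by rw [huf]; exact (min_le_left _ _).trans (min_le_right _ _)
  have hufd : uf ≤ 1 / (d : ℝ) := by rw [huf]; exact min_le_right _ _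
  have hufm1 : ufm ≤ 1 := by rw [hufm]; exact min_le_left _ _
  have hCEfm_le : CEfm ≤ CEf := by rw [hCEf]; exact le_max_left _ _
  have hCEf₀_le : CEf₀ ≤ CEf := by rw [hCEf]; exact le_max_right _ _
  have hCEf0 : 0 ≤ CEf := hCEfm0.trans hCEfm_le
  have hGf0 : 0 < Gf := by rw [hGf]; positivity
  have hug0 : 0 < ug := by rw [hug]; positivity
  refine ⟨ab, qb, Bf, uf, CEf, ug, hab0, hqb0, hBf1, huf0, hCEf0, hug0, ?_⟩
  intro G Qh c hc hc6 hc₃' hc₃''c hcc₀ hcug μ hμ U hU hU9 hU₀' hU₀''U hUU₁ hcU hUuf hUug β hβmin hβc L M _ _ hL3 hM3 n hn1 hnN hreg hhist hfr hosc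
    cc n' hreg' hnn' hccuf
    Ab Qb ι₂ X hAbs hQbs hι₂ hι₂s hX hXs Ab' ι₂' X' hAb' hι₂' hX'
    κb αb crb ccb hκb hαb hcrb hccb W Z σ Φ ψ τ ι₁ hW hZ hσ hΦ hψ hτ hι₁ hι₁s ρk Q' Q κA Yb Y A A' ι₃ hρk hQ' hQ hκA hYb hY hA hA' hι₃
    himp₁ himp₂ hcell Aro Qro Qtot Atot hAro hQro hQtot hAtot Qe hCE hsix hQe j hj
  have hβ : 0 < β := KLRegimeSplit.pos_of_klBetaMin_le hβmin
  have hβM : β ≤ M := beta_le_of_klEngM₃_le hM3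
  have hM0 : (0 : ℝ) < M := Nat.cast_pos.2 (Nat.pos_of_ne_zero (NeZero.ne M))
  have hKl : 0 ≤ P.Klam := hK0.le
  have hden : 0 < 2 * Bf * P.Klam + 1 := by positivity
  have hden1 : 1 ≤ 2 * Bf * P.Klam + 1 := le_add_of_nonneg_left (by positivity)
  have hUuf1 : U ≤ uf := hUuf.trans (div_le_self huf0.le hden1)
  have hUuf' : U ≤ ufm := hUuf1.trans hufm_le
  have hU1 : U ≤ 1 := hUuf'.trans hufm1
  have hAbpos : 0 < Ab := by rw [hAbs]; positivity
  have hQbnn : 0 ≤ Qb := by rw [hQbs]; positivity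
  have hεx : 0 < imagTimeWeight β M := by unfold imagTimeWeight; positivity
  obtain ⟨D, hD3, hDi, hcard⟩ := exists_degreeCap_all L M n
  have hDall : ∀ k, 1 ≤ k → d * k ≤ n → Fintype.card (SpaceTimeIdx L M × SectorLeg (sectorCount (d * k - 1))) / 2 ≤ D :=
    fun k _ hk => hDi (d * k - 1) (by omega)
  have hD0 : Fintype.card (SpaceTimeIdx L M × SectorLeg (sectorCount 0)) / 2 ≤ D := hDi 0 (Nat.zero_le _)
  obtain ⟨hBrow, hdoors, hCEpkg⟩ := hpkg β M hβ hβM U hU hUuf' Ab Qb ι₂ X hAbs hQbs hι₂ hι₂s hX hXs Ab' ι₂' X' hAb' hι₂' hX'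
    κb αb crb ccb hκb hαb hcrb hccb W Z σ Φ ψ τ ι₁ hW hZ hσ hΦ hψ hτ hι₁ hι₁s ρk Q' Q κA Yb Y A A' ι₃ hρk hQ' hQ hκA hYb hY hA hA' hι₃
  have hblock := hblk d hd₀d Cκ β M hCκ hCJ.ne' hβ.ne' hM0.ne' κb ccb Z ψ τ hκb hccb hZ hψ hτ
  have hlog : 0 < Real.log 4 := Real.log_pos (by norm_num)
  have hUufm : U ≤ ufm / (2 * Bf * P.Klam + 1) := hUuf.trans (div_le_div_of_nonneg_right hufm_le hden.le)
  have hUdoor := hUufm.trans (div_le_div_of_nonneg_right hdoors hden.le)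
  have hccufm : cc ≤ ufm * Real.log 4 / (2 * Bf * P.Klam + 1) :=
    hccuf.trans (div_le_div_of_nonneg_right (mul_le_mul_of_nonneg_right hufm_le hlog.le) hden.le)
  have hcdoor : cc ≤ min 1 (min (1 / (8 * σ * Q' + 1)) (min (1 / (2 * exp 1 * τ * Q' + 1)) (min (1 / (4 * Φ * τ * ι₁ + 1))
        (min (1 / (2 * (Φ * (exp 1 * τ * ι₁ + (exp 1 * τ) ^ 2 * ι₂' + (exp 1 * τ) ^ 3 * ι₃ + A' * (exp 1 * τ * Q') ^ 2 / 2)) + 1))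
          (min (A * Q ^ 3 / (16 * σ * Q' * A' * (4 * Q') ^ 3 + A * Q ^ 3))
            (A * Q ^ 3 / (16 * exp 1 * ψ * (2 * τ * ψ * Q') ^ 2 * Φ * τ ^ 2 * ι₁ ^ 2 + A * Q ^ 3))))))) * Real.log 4 / (2 * Bf * P.Klam + 1) :=
    hccufm.trans (div_le_div_of_nonneg_right (mul_le_mul_of_nonneg_right hdoors hlog.le) hden.le)
  have hε0 : ∀ i, 0 ≤ epsCoupling P U i := fun i => by unfold epsCoupling; positivity
  have hl0 : ∀ i, 0 ≤ Bf * epsCoupling P U i := fun i => mul_nonneg hBf0.le (hε0 i)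
  have hlam : ∀ i, i ≤ n → Bf * epsCoupling P U i ≤ uf := by
    intro i hi
    have hin' : (i : ℝ) ≤ n' := Nat.cast_le.2 (hi.trans hnn')
    have hreg'' : U ^ 2 * (n' : ℝ) * Real.log 4 ≤ cc := by
      have h := hreg'
      simp only [IsKLRegime, Int.cast_neg, Int.cast_natCast, abs_neg, Nat.abs_cast] at h
      exact h
    have h1 : U ^ 2 * (i : ℝ) ≤ uf / (2 * Bf * P.Klam + 1) := by
      have h2 : U ^ 2 * (n' : ℝ) ≤ cc / Real.log 4 := by rw [le_div_iff₀ hlog]; exact hreg''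
      have h3 : cc / Real.log 4 ≤ uf / (2 * Bf * P.Klam + 1) := by
        rw [div_le_iff₀ hlog]
        calc cc ≤ uf * Real.log 4 / (2 * Bf * P.Klam + 1) := hccuf
          _ = uf / (2 * Bf * P.Klam + 1) * Real.log 4 := by ring
      calc U ^ 2 * (i : ℝ) ≤ U ^ 2 * (n' : ℝ) := by gcongr
        _ ≤ uf / (2 * Bf * P.Klam + 1) := h2.trans h3
    unfold epsCoupling
    rw [abs_of_pos hU]
    calc Bf * (P.Klam * (U + U ^ 2 * (i : ℝ))) ≤ Bf * (P.Klam * (uf / (2 * Bf * P.Klam + 1) + uf / (2 * Bf * P.Klam + 1))) := by gcongr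
      _ = uf * (2 * Bf * P.Klam / (2 * Bf * P.Klam + 1)) := by field_simp; ring
      _ ≤ uf * 1 := by
          refine mul_le_mul_of_nonneg_left ?_ huf0.le
          rw [div_le_one hden]; linarith
      _ = uf := mul_one _
  have hlamd : Bf * epsCoupling P U d ≤ uf := by
    have hUd : U * (d : ℝ) ≤ 1 := by
      calc U * (d : ℝ) ≤ (1 / (d : ℝ)) * d := by gcongr; exact hUuf1.trans hufd
        _ = 1 := by field_simp
    have h1 : Bf * P.Klam * U ≤ uf / 2 := by
      have h2 : Bf * P.Klam * U ≤ Bf * P.Klam * (uf / (2 * Bf * P.Klam + 1)) := by gcongr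
      have h3 : Bf * P.Klam * (uf / (2 * Bf * P.Klam + 1)) ≤ uf / 2 := by
        rw [mul_div_assoc', div_le_div_iff₀ hden (by norm_num)]
        have : 0 ≤ Bf * P.Klam * uf := by positivity
        linarith
      exact h2.trans h3
    have h0 : 0 ≤ Bf * P.Klam * U := by positivity
    unfold epsCoupling
    rw [abs_of_pos hU]
    calc Bf * (P.Klam * (U + U ^ 2 * (d : ℝ))) = Bf * P.Klam * U + Bf * P.Klam * U * (U * (d : ℝ)) := by ring
      _ ≤ uf / 2 + uf / 2 * 1 := add_le_add h1 (mul_le_mul h1 hUd (by positivity) (by positivity))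
      _ = uf := by ring
  have hlamm : ∀ i, i ≤ n → Bf * epsCoupling P U i ≤ ufm := fun i hi => (hlam i hi).trans hufm_le
  have hCEmain : ∀ i : ℕ, d ≤ i → i ≤ n → Qtot * imagTimeWeight β M ^ 2 * Bf * max 1 (Atot i / imagTimeWeight β M) ≤ Qe.CE :=
    fun i _ hi => ((hCEpkg (Bf * epsCoupling P U i) (hl0 i) (hlamm i hi) Aro Qro Qtot (Atot i) hAro hQro hQtot (hAtot i)).trans hCEfm_le).trans hCE
  obtain ⟨Ab₀, hAb₀⟩ : ∃ x : ℝ, x = A₁ * imagTimeWeight β M / P.Klam ^ 2 / Bf ^ 2 := ⟨_, rfl⟩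
  obtain ⟨Qb₀, hQb₀⟩ : ∃ x : ℝ, x = P₁ / imagTimeWeight β M ^ 2 := ⟨_, rfl⟩
  have hAb₀s : Ab₀ = ab₀ * (β / M) / Bf ^ 2 := by rw [hAb₀, hab₀, imagTimeWeight]; field_simp
  have hQb₀s : Qb₀ = qb₀ * ((M : ℝ) / β) ^ 2 := by rw [hQb₀, hqb₀, imagTimeWeight]; field_simp; ring
  have hAb₀0 : 0 ≤ Ab₀ := by rw [hAb₀]; positivity
  obtain ⟨κb₀, hκb₀⟩ : ∃ x : ℝ, x = Real.sqrt (2 * Cκ₀ * klE0) := ⟨_, rfl⟩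
  obtain ⟨αb₀, hαb₀⟩ : ∃ x : ℝ, x = Cb₀ * ((M : ℝ) / β) * (4 : ℝ) ^ d / klE0 := ⟨_, rfl⟩
  obtain ⟨crb₀, hcrb₀⟩ : ∃ x : ℝ, x = 81 * CJ₀ * M / β := ⟨_, rfl⟩
  obtain ⟨ccb₀, hccb₀⟩ : ∃ x : ℝ, x = 162 * CJ₀ * M / β := ⟨_, rfl⟩
  obtain ⟨W₀, hW₀⟩ : ∃ x : ℝ, x = 64 * (27 : ℝ) ^ 4 * exp 2 * crb₀ / ccb₀ := ⟨_, rfl⟩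
  obtain ⟨Z₀, hZ₀⟩ : ∃ x : ℝ, x = exp 4 * ccb₀ ^ 2 * imagTimeWeight β M ^ 2 / 8 := ⟨_, rfl⟩
  obtain ⟨σ₀, hσ₀⟩ : ∃ x : ℝ, x = κb₀ ^ 2 / (exp 4 * ccb₀ ^ 2) := ⟨_, rfl⟩
  obtain ⟨Φ₀, hΦ₀⟩ : ∃ x : ℝ, x = 9 * αb₀ * ccb₀ / ((27 : ℝ) ^ 5 * exp 1 * κb₀ ^ 2 * crb₀) := ⟨_, rfl⟩
  obtain ⟨ψ₀, hψ₀⟩ : ∃ x : ℝ, x = exp 4 * ccb₀ ^ 2 / κb₀ ^ 2 := ⟨_, rfl⟩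
  obtain ⟨τ₀, hτ₀⟩ : ∃ x : ℝ, x = exp 2 * κb₀ ^ 2 / ccb₀ ^ 2 := ⟨_, rfl⟩
  have hW₀z : W₀ = zW := by rw [hzW]; exact levPin_W hCJ₀.ne' hβ.ne' hM0.ne' hcrb₀ hccb₀ hW₀
  have hZ₀z : Z₀ = zZ := by rw [hzZ]; exact levPin_Z hβ.ne' hM0.ne' hccb₀ hZ₀
  obtain ⟨A'₀, hA'₀⟩ : ∃ x : ℝ, x = (27 : ℝ) ^ 5 * W₀ * Ab₀ := ⟨_, rfl⟩
  obtain ⟨Q'₀, hQ'₀⟩ : ∃ x : ℝ, x = Z₀ * Qb₀ + 1 := ⟨_, rfl⟩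
  obtain ⟨ι₃₀, hι₃₀⟩ : ∃ x : ℝ, x = A'₀ * Q'₀ ^ 3 := ⟨_, rfl⟩
  have hε1 : 0 < epsCoupling P U 1 := by
    unfold epsCoupling
    have : 0 < |U| + U ^ 2 * ((1 : ℕ) : ℝ) := by positivity
    positivity
  have hl1 : 0 < Bf * epsCoupling P U 1 := mul_pos hBf0 hε1
  obtain ⟨ι₁₀, hι₁₀⟩ : ∃ x : ℝ, x = W₀ * Z₀ * ((27 : ℝ) ^ 5 * (T₁ * (|U| + c) / imagTimeWeight β M)) / (Bf * epsCoupling P U 1) := ⟨_, rfl⟩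
  obtain ⟨ι₂₀, hι₂₀⟩ : ∃ x : ℝ, x = W₀ * Z₀ ^ 2 * ((27 : ℝ) ^ 5 * (A₁ * P₁ ^ 2 * |U| / imagTimeWeight β M ^ 3)) / (Bf * epsCoupling P U 1) := ⟨_, rfl⟩
  have hι₁₀0 : 0 ≤ ι₁₀ := by rw [hι₁₀, hW₀z, hZ₀z]; positivity
  have hι₂₀0 : 0 ≤ ι₂₀ := by rw [hι₂₀, hW₀z, hZ₀z]; positivity
  have hι₂₀s : ι₂₀ ≤ i₂₀ * ((M : ℝ) / β) ^ 3 / Bf := by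
    rw [hι₂₀, hW₀z, hZ₀z, hi₂₀, div_le_iff₀ hl1]
    unfold epsCoupling imagTimeWeight
    rw [abs_of_pos hU]
    have hkey : zW * zZ ^ 2 * ((27 : ℝ) ^ 5 * (A₁ * P₁ ^ 2 * U / (β / (2 * (M : ℝ))) ^ 3)) =
        8 * (27 : ℝ) ^ 5 * zW * zZ ^ 2 * A₁ * P₁ ^ 2 / P.Klam * ((M : ℝ) / β) ^ 3 / Bf * (Bf * (P.Klam * U)) := by
      field_simp
      ring
    rw [hkey]
    have hU2 : U ≤ U + U ^ 2 * ((1 : ℕ) : ℝ) := by simp only [Nat.cast_one, mul_one]; linarith [sq_nonneg U]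
    have h0 : 0 ≤ 8 * (27 : ℝ) ^ 5 * zW * zZ ^ 2 * A₁ * P₁ ^ 2 / P.Klam * ((M : ℝ) / β) ^ 3 / Bf := by positivity
    exact mul_le_mul_of_nonneg_left (mul_le_mul_of_nonneg_left (mul_le_mul_of_nonneg_left hU2 hKl) hBf0.le) h0
  have hεle : ∀ j : ℕ, j ≤ d → epsCoupling P U j ≤ ((d : ℝ) + 1) * epsCoupling P U 1 := by
    intro j hjd
    unfold epsCoupling; rw [abs_of_pos hU]
    have hj' : (j : ℝ) ≤ d := Nat.cast_le.2 hjd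
    have h1 : P.Klam * (U + U ^ 2 * (j : ℝ)) ≤ P.Klam * (U + U ^ 2 * (d : ℝ)) := by gcongr
    have h2 : P.Klam * (U + U ^ 2 * (d : ℝ)) + P.Klam * ((d : ℝ) * U + U ^ 2) = ((d : ℝ) + 1) * (P.Klam * (U + U ^ 2 * ((1 : ℕ) : ℝ))) := by
      push_cast; ring
    have h3 : 0 ≤ P.Klam * ((d : ℝ) * U + U ^ 2) := by positivity
    linarith
  have hprod : ∀ j : ℕ, j ≤ d → ι₁₀ * (Bf * epsCoupling P U j) ≤ ((M : ℝ) / β) / Bf := by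
    intro j hjd
    have hstep : ι₁₀ * (Bf * epsCoupling P U j) ≤ ι₁₀ * (Bf * (((d : ℝ) + 1) * epsCoupling P U 1)) := by
      have := hεle j hjd; gcongr
    refine hstep.trans ?_
    rw [hι₁₀, hW₀z, hZ₀z]
    have hUc : |U| + c ≤ 2 * ug := by rw [abs_of_pos hU]; linarith
    have hkey : 2 * Gf * ug ≤ 1 / Bf := by
      rw [hug, mul_one_div, div_le_div_iff₀ (by positivity) hBf0]; linarith
    have e1 : zW * zZ * ((27 : ℝ) ^ 5 * (T₁ * (|U| + c) / imagTimeWeight β M)) / (Bf * epsCoupling P U 1) * (Bf * (((d : ℝ) + 1) * epsCoupling P U 1)) =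
        Gf * (|U| + c) / 2 * (1 / imagTimeWeight β M) := by rw [hGf]; field_simp
    have e2 : (1 : ℝ) / imagTimeWeight β M = 2 * ((M : ℝ) / β) := by unfold imagTimeWeight; field_simp
    rw [e1, e2]
    have hMβ0 : 0 ≤ (M : ℝ) / β := by positivity
    calc Gf * (|U| + c) / 2 * (2 * ((M : ℝ) / β)) = Gf * (|U| + c) * ((M : ℝ) / β) := by ring
      _ ≤ Gf * (2 * ug) * ((M : ℝ) / β) := by gcongr
      _ = 2 * Gf * ug * ((M : ℝ) / β) := by ring
      _ ≤ 1 / Bf * ((M : ℝ) / β) := mul_le_mul_of_nonneg_right hkey hMβ0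
      _ = ((M : ℝ) / β) / Bf := by ring
  obtain ⟨⟨_, hQb₀0, hA'₀0, hQ'₀0, hZQ₀, hι₃₀0, hZQ3, _, _, hW₀0, hZ₀0⟩, hsmallZ, hCEZ, hdomZ⟩ :=
    hpkgZ β M hβ hβM Ab₀ Qb₀ ι₂₀ hAb₀s hQb₀s hι₂₀0 hι₂₀s κb₀ αb₀ crb₀ ccb₀ hκb₀ hαb₀ hcrb₀ hccb₀ W₀ Z₀ σ₀ Φ₀ ψ₀ τ₀ hW₀ hZ₀ hσ₀ hΦ₀ hψ₀ hτ₀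
      A'₀ Q'₀ ι₃₀ hA'₀ hQ'₀ hι₃₀
  have hrowA : W₀ * (27 : ℝ) ^ 5 * Ab₀ ≤ A'₀ := by rw [hA'₀]; exact le_of_eq (by ring)
  have hrow3 : W₀ * Z₀ ^ 3 * ((27 : ℝ) ^ 5 * Ab₀ * Qb₀ ^ 3) ≤ ι₃₀ := by
    rw [hι₃₀, hA'₀]
    calc W₀ * Z₀ ^ 3 * ((27 : ℝ) ^ 5 * Ab₀ * Qb₀ ^ 3) = (27 : ℝ) ^ 5 * W₀ * Ab₀ * (Z₀ ^ 3 * Qb₀ ^ 3) := by ring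
      _ ≤ (27 : ℝ) ^ 5 * W₀ * Ab₀ * Q'₀ ^ 3 := mul_le_mul_of_nonneg_left hZQ3 (by positivity)
  have hrow1 : W₀ * Z₀ * ((27 : ℝ) ^ 5 * (T₁ * (|U| + c) / imagTimeWeight β M)) ≤ ι₁₀ * (Bf * epsCoupling P U 1) := by
    rw [hι₁₀, div_mul_cancel₀ _ hl1.ne']
  have hrow2 : W₀ * Z₀ ^ 2 * ((27 : ℝ) ^ 5 * (A₁ * P₁ ^ 2 * |U| / imagTimeWeight β M ^ 3)) ≤ ι₂₀ * (Bf * epsCoupling P U 1) := by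
    rw [hι₂₀, div_mul_cancel₀ _ hl1.ne']
  have hsmall₀ : ∀ j : ℕ, 1 ≤ j → j ≤ d → j ≤ n →
      4 * σ₀ * (Bf * epsCoupling P U j) * Q'₀ < 1 ∧ 2 * (Bf * epsCoupling P U j) * τ₀ * Q'₀ ≤ 1 ∧ exp 1 * τ₀ * (Bf * epsCoupling P U j) * Q'₀ < 1 ∧
      Φ₀ * (τ₀ * (ι₁₀ * (Bf * epsCoupling P U j) + ι₂₀ / (2 * Q'₀) + ι₃₀ / (4 * Q'₀ ^ 2) + A'₀ * Q'₀ / 4)) < 1 ∧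
      Φ₀ * (exp 1 * τ₀ * (ι₁₀ * (Bf * epsCoupling P U j)) + (exp 1 * τ₀) ^ 2 * (ι₂₀ * (Bf * epsCoupling P U j)) +
          (exp 1 * τ₀) ^ 3 * (ι₃₀ * (Bf * epsCoupling P U j) ^ 2) +
        A'₀ * (exp 1 * τ₀ * Q'₀) * ((exp 1 * τ₀ * (Bf * epsCoupling P U j) * Q'₀) ^ 3 / (1 - exp 1 * τ₀ * (Bf * epsCoupling P U j) * Q'₀))) < 1 :=
    fun j _ hjd hjn => hsmallZ (Bf * epsCoupling P U j) ι₁₀ (hl0 j) ((hlam j hjn).trans huf₀_le) hι₁₀0 (hprod j hjd)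
  obtain ⟨Qtot₀, hQtot₀⟩ : ∃ x : ℝ, x = Dinc₀ * max 1 (max (Dinc₀ * Qb₀) (max (4 * Q'₀) (2 * τ₀ * ψ₀ * Q'₀))) := ⟨_, rfl⟩
  obtain ⟨Atot₀, hAtot₀⟩ : ∃ f : ℕ → ℝ, ∀ j : ℕ, f j = Cinc₀ * Ab₀ + Cinc₀ * (A'₀ * (4 * σ₀ * (Bf * epsCoupling P U j) * Q'₀ / (1 - 4 * σ₀ * (Bf * epsCoupling P U j) * Q'₀)) +
      exp 1 * (τ₀ * (ι₁₀ * (Bf * epsCoupling P U j) + ι₂₀ / (2 * Q'₀) + ι₃₀ / (4 * Q'₀ ^ 2) + A'₀ * Q'₀ / 4)) *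
        (Φ₀ * (τ₀ * (ι₁₀ * (Bf * epsCoupling P U j) + ι₂₀ / (2 * Q'₀) + ι₃₀ / (4 * Q'₀ ^ 2) + A'₀ * Q'₀ / 4)) /
          (1 - Φ₀ * (τ₀ * (ι₁₀ * (Bf * epsCoupling P U j) + ι₂₀ / (2 * Q'₀) + ι₃₀ / (4 * Q'₀ ^ 2) + A'₀ * Q'₀ / 4)))) / (2 * τ₀ * Q'₀)) :=
    ⟨_, fun _ => rfl⟩
  have hCE₀ : ∀ j : ℕ, 1 ≤ j → j < d → j ≤ n → Qtot₀ * imagTimeWeight β M ^ 2 * Bf * max 1 (Atot₀ j / imagTimeWeight β M) ≤ Qe.CE :=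
    fun j _ hjd hjn => ((hCEZ (Bf * epsCoupling P U j) ι₁₀ (hl0 j) ((hlam j hjn).trans huf₀_le) hι₁₀0 (hprod j hjd.le)
      (Cinc₀ * Ab₀) (Dinc₀ * Qb₀) Qtot₀ (Atot₀ j) rfl rfl hQtot₀ (hAtot₀ j)).trans hCEf₀_le).trans hCE
  obtain ⟨Qtot₁, hQtot₁⟩ : ∃ x : ℝ, x = Dinc₁ * max 1 (max (Dinc₁ * Qb₀) (max (4 * Q'₀) (2 * τ₀ * ψ₀ * Q'₀))) := ⟨_, rfl⟩
  obtain ⟨Atot₁, hAtot₁⟩ : ∃ x : ℝ, x = Cinc₁ * Ab₀ + Cinc₁ * (A'₀ * (4 * σ₀ * (Bf * epsCoupling P U d) * Q'₀ / (1 - 4 * σ₀ * (Bf * epsCoupling P U d) * Q'₀)) +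
      exp 1 * (τ₀ * (ι₁₀ * (Bf * epsCoupling P U d) + ι₂₀ / (2 * Q'₀) + ι₃₀ / (4 * Q'₀ ^ 2) + A'₀ * Q'₀ / 4)) *
        (Φ₀ * (τ₀ * (ι₁₀ * (Bf * epsCoupling P U d) + ι₂₀ / (2 * Q'₀) + ι₃₀ / (4 * Q'₀ ^ 2) + A'₀ * Q'₀ / 4)) /
          (1 - Φ₀ * (τ₀ * (ι₁₀ * (Bf * epsCoupling P U d) + ι₂₀ / (2 * Q'₀) + ι₃₀ / (4 * Q'₀ ^ 2) + A'₀ * Q'₀ / 4)))) / (2 * τ₀ * Q'₀)) :=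
    ⟨_, rfl⟩
  obtain ⟨hdomA, hdomQ⟩ := hdomZ (Bf * epsCoupling P U d) ι₁₀ (hl0 d) (hlamd.trans huf₀_le) hι₁₀0 (hprod d le_rfl)
    (Cinc₁ * Ab₀) (Dinc₁ * Qb₀) Qtot₁ Atot₁ rfl rfl hQtot₁ hAtot₁
  have hAtle : Atot₁ ≤ Ab' := by rw [hAb', hAbs]; exact hdomA
  have hQtle : Qtot₁ ≤ Qb := by rw [hQbs]; exact hdomQ
  exact h' G Qh c hc hc6 hc₃' hc₃''c hcc₀ μ hμ U hU hU9 hU₀' hU₀''U hUU₁ hcU β hβmin hβc L M hL3 hM3 n hn1 hnN hreg hhist hfr hosc hd2 D hD3 cc n' hreg' hnn'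
    Bf hBf1 Ab Qb ι₂ X hAbpos hQbnn hι₂ hX Ab' ι₂' X' hAb' hι₂' hX'
    κb αb crb ccb hκb hαb hcrb hccb hDall W Z σ Φ ψ τ ι₁ hW hZ hσ hΦ hψ hτ hι₁ ρk Q' Q κA Yb Y A A' ι₃ hρk hQ' hQ hκA hYb hY hA hA' hι₃ hblock hBrow
    himp₁ himp₂ hcell hUdoor hcdoor Aro Qro Qtot Atot hAro hQro hQtot hAtot Qe hCEmain hcard hsix
    Ab₀ Qb₀ hAb₀ hQb₀ hD0 κb₀ αb₀ crb₀ ccb₀ hκb₀ hαb₀ hcrb₀ hccb₀ W₀ Z₀ σ₀ Φ₀ ψ₀ τ₀ hW₀ hZ₀ hσ₀ hΦ₀ hψ₀ hτ₀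
    A'₀ Q'₀ ι₁₀ ι₂₀ ι₃₀ hA'₀0 hQ'₀0 hrowA hZQ₀ hrow3 hrow1 hrow2 hsmall₀
    (Cinc₀ * Ab₀) (Dinc₀ * Qb₀) Qtot₀ Atot₀ rfl rfl hQtot₀ hAtot₀ hCE₀
    (Cinc₁ * Ab₀) (Dinc₁ * Qb₀) Qtot₁ Atot₁ rfl rfl hQtot₁ hAtot₁ hAtle hQtle
    hQe j hj

end Summit.HubbardSuperconductivity.HubbardSuperconductivity.Theorems.EngineV8

end
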